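import Summits.AtomisticToContinuum.HydrodynamicLimit.Theorems.StiffCollisionalRelaxationAprioriBoundsFibreLinStatL1Glue
import Summits.AtomisticToContinuum.HydrodynamicLimit.Theorems.StiffCollisionalRelaxationAprioriBoundsFibreEnergyMoment
import Summits.AtomisticToContinuum.HydrodynamicLimit.Theorems.StiffCollisionalRelaxationAprioriBoundsFibreReduction
import Summits.AtomisticToContinuum.HydrodynamicLimit.Theorems.StiffCollisionalRelaxationAprioriBoundsEntropyRange
import Summits.AtomisticToContinuum.HydrodynamicLimit.Theses.ImplosionDichotomy
import HarnessLib

/-!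
# The stub `stub_linStatL1` of the line `fibre-deficit-transfer` (skeleton r4) from the profile-wise packing-guarded hydrodynamic
limit, hence from the conjunct Statement (crux `AprioriBounds`, stmt-AtomisticToContinuum-14827)

Support file (`--supports stmt-AtomisticToContinuum-14827`) of the stub-worker of `stub_linStatL1`, the OPEN dynamical input of the
rate-free (i)-chain: under the crux prefix, `LinStatL1VanishAt σ a₀ θ₀ u₀ ρ θ u Φ t` (`∫₀ᵗ E_N|ℓ_s ∘ Φ_s| ds → 0`).  This file settles
its STATUS: the registered stub follows VERBATIM from

* `stub_linStatL1_of_hydroLimitProfilewiseBand` (registered sub-goal): the open route item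
  `Theses.ImplosionDichotomy.HydroLimitProfilewiseBand` (stmt-AtomisticToContinuum-17372, crux, open) — the PROFILE-WISE
  packing-guarded hydrodynamic limit (`∀ profiles ∃ η ∃ σ₀ …`, convergence in probability of the three empirical fields at every
  `t < T` for classical solutions with `ρσ³ < η` on `[0, T)`), the nearest item of exactly the crux prefix's strength;
* `stub_linStatL1_of_hydrodynamicLimit`: the conjunct Statement `_root_.HydrodynamicLimit` itself (`∃ η₀ ∀ profiles ∃ σ₀ …`,
  which implies the profile-wise item, `hydroLimitProfilewiseBand_of_hydrodynamicLimit`).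

Proof of the reduction: choose `σ₀ := min σ₀' (1/2)` and the chamber threshold `η₁ := min η η_e` (`η` the item's band for the
profiles, `η_e` the low-density equation-of-state threshold of the LANDED `hsEosLowDensity_proof`, below which `f_ex`, `f_ex'` are
continuous, `eos_continuousOn`); given the crux data, the chamber `2ρσ³ < η₁` on `[0, t]` gives `ρσ³ < η` there, which
extends to a life `[0, T')`, `t < T' ≤ T` (`AdiabatCeiling.exists_chamber_extension`); restrict the solution to `[0, T')`
(`IsHardSphereEulerSolution.restrict`) and run the item with horizon `T'`: the fields converge in probability at every
`s ∈ [0, t] ⊆ [0, T')`.  The classical solution supplies fields jointly continuous on `[0,t] × 𝕋³` with `ρ, θ > 0`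
(`fields_continuousOn`) and, inside the chamber `ρσ³ < η_e`, a jointly continuous density multiplier `λ₀` (`lam0_continuousOn`;
both with `eos_continuousOn` the lead's landed glue of `…FibreReduction`); `EnergyMomentAt` is the landed `stub_energyMoment`; the
glue `linStatL1_of_hydroLimitOn` (`…FibreLinStatL1Glue`) concludes.

No new definitions, no named facts; axioms `propext`, `Classical.choice`, `Quot.sound`.
-/

noncomputable section

open MeasureTheory Filter Set Topology
open scoped ENNReal

namespace Summit.AtomisticToContinuum.HydrodynamicLimit.Theorems.FibreDeficitTransfer

open Literature.MathematicalPhysics.KineticTheory Literature.Analysis.FluidPDE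
open Summit.AtomisticToContinuum.HydrodynamicLimit.Theorems.AprioriBoundsNegative (PartOneAt PartTwoAt)
open Summit.AtomisticToContinuum.HydrodynamicLimit.Theorems.VisitLedgerUpscattering (Cfg Flow Flows NiceProfiles)

namespace LinStatL1

/-- The conjunct Statement (`∃ η₀ ∀ profiles ∃ σ₀ …`) implies the profile-wise packing-guarded hydrodynamic limit
(`∀ profiles ∃ η ∃ σ₀ …`, route item `Theses.ImplosionDichotomy.HydroLimitProfilewiseBand`, stmt-17372). -/
theorem hydroLimitProfilewiseBand_of_hydrodynamicLimit (h : _root_.HydrodynamicLimit) :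
    Summit.AtomisticToContinuum.HydrodynamicLimit.Theses.ImplosionDichotomy.HydroLimitProfilewiseBand := by
  obtain ⟨η₀, hη₀, H⟩ := h
  intro a₀ θ₀ u₀ ha hθ hu ha0 hθ0
  obtain ⟨σ₀, hσ₀, H1⟩ := H a₀ θ₀ u₀ ha hθ hu ha0 hθ0
  exact ⟨η₀, hη₀, σ₀, hσ₀, H1⟩

end LinStatL1

open LinStatL1 in
/-- **`stub_linStatL1` FROM THE PROFILE-WISE PACKING-GUARDED HYDRODYNAMIC LIMIT** (registered sub-goal
`stub_linStatL1_of_hydroLimitProfilewiseBand` of the crux): the open route item `Theses.ImplosionDichotomy.HydroLimitProfilewiseBand`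
(stmt-AtomisticToContinuum-17372) implies the registered stub `stub_linStatL1` of skeleton r4 VERBATIM, with `σ₀ := min σ₀' (1/2)` and
`η₁ := min η η_e`: chamber extension to a life `[0, T')` + restriction of the solution + the item at horizon `T'` give the field
convergence at every `s ∈ [0, t]`; the classical solution and the low-density equation of state give the regularity; `stub_energyMoment`
the energy moment; `linStatL1_of_hydroLimitOn` concludes. -/
theorem stub_linStatL1_of_hydroLimitProfilewiseBand : Summit.AtomisticToContinuum.HydrodynamicLimit.Theses.ImplosionDichotomy.HydroLimitProfilewiseBand → ∀ (a₀ θ₀ : T3 → ℝ) (u₀ : T3 → V3), Continuous a₀ → Continuous θ₀ → Continuous u₀ → (∀ x, 0 < a₀ x) → (∀ x, 0 < θ₀ x) → ∃ σ₀ : ℝ, 0 < σ₀ ∧ ∃ η₁ : ℝ, 0 < η₁ ∧ ∀ σ : ℝ, 0 < σ → σ < σ₀ → ∀ (T : ℝ) (ρ θ : ℝ → T3 → ℝ) (u : ℝ → T3 → V3), IsHardSphereEulerSolution σ T ρ u θ → ∀ Φ : (N : ℕ) → HardSphereFlow (Torus.geometry (Fin 3)) (hsDiameter σ N) (N + 1),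 TendstoHydroFieldsAt (fun N => localGibbsLaw σ a₀ u₀ θ₀ N (Φ N)) Φ ρ u θ 0 → ∀ t : ℝ, 0 < t → t < T → (∀ s ∈ Icc 0 t, ∀ x, 2 * ρ s x * σ ^ 3 < η₁) → LinStatL1VanishAt σ a₀ θ₀ u₀ ρ θ u Φ t := by
  intro hHL a₀ θ₀ u₀ ha hθ hu ha0 hθ0
  obtain ⟨η, hη, σ₁, hσ₁, H⟩ := hHL a₀ θ₀ u₀ ha hθ hu ha0 hθ0
  obtain ⟨ηe, hηe, hfe, hdfe⟩ := eos_continuousOn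
  have hP : NiceProfiles a₀ θ₀ u₀ := ⟨ha, hθ, hu, ha0, hθ0⟩
  refine ⟨min σ₁ (1 / 2), lt_min hσ₁ one_half_pos, min η ηe, lt_min hη hηe, ?_⟩
  intro σ hσ hσlt T ρ θ u hsol Φ hLLN t ht htT hdil
  obtain ⟨hs1, hshalf⟩ := lt_min_iff.1 hσlt
  obtain ⟨hρc, hθc, huc, hθpos, hρpos⟩ := fields_continuousOn hsol htT
  -- the chamber on `[0, t]`: `ρσ³ < η` and `ρσ³ < η_e`
  have hch2 : ∀ s ∈ Icc 0 t, ∀ x, 2 * (ρ s x * σ ^ 3) < min η ηe := fun s hs x => by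
    have h := hdil s hs x
    linarith
  have hpos3 : ∀ s ∈ Icc 0 t, ∀ x, 0 < ρ s x * σ ^ 3 := fun s hs x => mul_pos (hρpos s hs x) (pow_pos hσ 3)
  have hch : ∀ s ∈ Icc 0 t, ∀ x, ρ s x * σ ^ 3 < η := fun s hs x => by
    linarith [hch2 s hs x, hpos3 s hs x, min_le_left η ηe]
  have hche : ∀ s ∈ Icc 0 t, ∀ x, ρ s x * σ ^ 3 < ηe := fun s hs x => by
    linarith [hch2 s hs x, hpos3 s hs x, min_le_right η ηe]
  -- extend the chamber to a life `[0, T')`, restrict the solution, run the item with horizon `T'`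
  obtain ⟨T', htT', hT'T, hch'⟩ := AdiabatCeiling.exists_chamber_extension hsol hσ ht.le htT hch
  have hsol' := hsol.restrict hT'T
  have hH : ∀ s ∈ Icc 0 t, TendstoHydroFieldsAt (fun N => localGibbsLaw σ a₀ u₀ θ₀ N (Φ N)) Φ ρ u θ s := fun s hs =>
    H σ hσ hs1 T' ρ θ u hsol' hch' Φ hLLN s ⟨hs.1, lt_of_le_of_lt hs.2 htT'⟩
  -- regularity of `λ₀` in the chamber, the energy moment, and the glue
  have hΛ := lam0_continuousOn hσ hfe hdfe hρc hθc huc hρpos hθpos hche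
  exact linStatL1_of_hydroLimitOn σ a₀ θ₀ u₀ ρ θ u Φ t hshalf.le hP ht.le hρc hθc huc hθpos hΛ hH
    (stub_energyMoment σ a₀ θ₀ u₀ Φ hσ hshalf.le hP)

open LinStatL1 in
/-- **`stub_linStatL1` FROM THE CONJUNCT**: the summit conjunct `_root_.HydrodynamicLimit` (the packing-guarded hydrodynamic limit of
hard spheres, `Summits/AtomisticToContinuum/HydrodynamicLimit/Statement.lean`) implies the registered stub `stub_linStatL1` verbatim —
the formal content of "the dynamical input of the rate-free chain is conjunct-strength". -/
theorem stub_linStatL1_of_hydrodynamicLimit : _root_.HydrodynamicLimit → ∀ (a₀ θ₀ : T3 → ℝ) (u₀ : T3 → V3), Continuous a₀ → Continuous θ₀ → Continuous u₀ → (∀ x, 0 < a₀ x) → (∀ x, 0 < θ₀ x) → ∃ σ₀ : ℝ, 0 < σ₀ ∧ ∃ η₁ : ℝ, 0 < η₁ ∧ ∀ σ : ℝ, 0 < σ → σ < σ₀ → ∀ (T : ℝ) (ρ θ : ℝ → T3 → ℝ) (u : ℝ → T3 → V3), IsHardSphereEulerSolution σ T ρ u θ → ∀ Φ : (N : ℕ)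 → HardSphereFlow (Torus.geometry (Fin 3)) (hsDiameter σ N) (N + 1), TendstoHydroFieldsAt (fun N => localGibbsLaw σ a₀ u₀ θ₀ N (Φ N)) Φ ρ u θ 0 → ∀ t : ℝ, 0 < t → t < T → (∀ s ∈ Icc 0 t, ∀ x, 2 * ρ s x * σ ^ 3 < η₁) → LinStatL1VanishAt σ a₀ θ₀ u₀ ρ θ u Φ t :=
  fun h => stub_linStatL1_of_hydroLimitProfilewiseBand (hydroLimitProfilewiseBand_of_hydrodynamicLimit h)

end Summit.AtomisticToContinuum.HydrodynamicLimit.Theorems.FibreDeficitTransfer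

end
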